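import Literature.NumberTheory.LFunctions.WeilSemilocalQuadratic
import Literature.NumberTheory.LFunctions.WeilSemilocalNegative
import Literature.NumberTheory.LFunctions.WeilExplicitContinuous
import Literature.NumberTheory.LFunctions.WeilMellinBounds
import Literature.NumberTheory.LFunctions.RiemannSiegelStirling
import Literature.Analysis.SpecialFunctions.KernelLog
import HarnessLib

/-!
# An explicit negative window for the semi-local Weil form at `S = {∞, 2}`

Topic: `Literature/NumberTheory/LFunctions`. The semi-local Weil functional
`W_{∞,2}` (`weilSemilocalFunctional {2}`, `WeilSemilocalQuadratic.lean`) is non-negative on the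
cone `C(a)` of test functions supported in `[-a, a]` for `a ≤ 563/1024`
(`weilSemilocalPositivityOn_two_certb`) and fails to be non-negative for all large `a`
(`exists_not_weilSemilocalPositivityOn_two`, a soft dilation argument with no explicit window).
This file makes the failure **explicit at the first arithmetic scale**:

* `not_weilSemilocalPositivityOn_two_log_two` — **`W_{∞,2}` is not `≥ 0` on `C(log 2)`**;
* `not_weilSemilocalPositivityOn_two_of_log_two_le` — hence not on any `C(a)`, `a ≥ log 2`.

So the positivity threshold of the `{∞, 2}` form lies in `[563/1024, log 2)`.

The proof has three ingredients.

1. **A Jensen-type archimedean bound** (`weilArch_le_of_jensen`): every term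
   `f_l(t) = 2t²/(l(l²+t²))` of the vertical series of `Re ψ(1/4 + it/2)` is concave in `t²`, so
   `Re ψ(1/4 + it/2) ≤ Re ψ(1/4 + iτ/2) + K(τ)(t² − τ²)` with `K(τ) ≥ 0`
   (`reDigammaQuarter_le_tangent`); integrating against `|ĝ(1/2+it)|²` and using Plancherel for
   `g` and `g'` (`(1/2π)∫ t²|ĝ|² = ‖g'‖₂²`, `integral_sq_mul_norm_sq_weilMellin`) gives
   `(1/2π) ∫ |ĝ(1/2+it)|² Re ψ(1/4+it/2) dt ≤ Re ψ(1/4 + iτ/2) ‖g‖₂²` whenever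
   `‖g'‖₂² ≤ τ² ‖g‖₂²`.
2. **An explicit odd witness**: `G(x) = sin(2πx/b)` on `[-b, b]`, `b = 69/100 < log 2`, extended
   by `0` (continuous, odd), mollified to test functions `g_k = G ⋆ φ_k`
   (`WeilContinuous.moll`). Oddness kills the polar term (`ĝ(1) = -ĝ(0)`), the derivative of the
   mollification obeys `‖g_k'‖₂² ≤ ‖G'‖₂² = ω² b` (`ω = 2π/b`; differentiation under the
   convolution, one integration by parts, Cauchy–Schwarz and Fubini), and dominated convergence
   gives `‖g_k‖₂² → b`, `(g_k ⋆ g̃_k)(±log 2) → P = ½(2b − log 2)cos ε + sin ε/(2ω)`,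
   `ε = ω log 2 − 2π`.
3. **Numerics by kernel arithmetic only**: `Re ψ(1/4 + (23/5) i) ≤ 1.5358` (Jensen parameter
   `τ = 46/5`) from the second-order Stirling bound `Complex.abs_re_digamma_sub_log_norm_add_re_le`
   and a kernel enclosure of `log (8489/400)` (`KernelLog.logIv`), `log π ≥ 1.14472` likewise,
   `P > 0.343`, `ω² b ≤ τ²·0.685`; for `k` large,
   `E₂(g_k) ≤ (1.5358 − 1.14472)·0.695 − (√2 log 2/2)·(2·0.343) < −0.06 < 0`.

All statements are about the objects of `WeilFirstPrimeQuadratic.lean` /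
`WeilSemilocalQuadratic.lean`; the passage `W_{∞,2} ↔ E₂` on `C(log 2)` is
`weilSemilocalPositivityOn_two_iff`.

## References

* H. Yoshida, *On Hermitian forms attached to zeta functions*, Adv. Stud. Pure Math. 21 (1992),
  §2 eq. (2.1) (the analytic form of the hermitian form; the weight `Re ψ(1/4 + it/2)`), §6
  (its vertical series), Thm 1 (positivity for `a = (log 2)/2`, all places). [Yoshida1992]
* E. Bombieri, *Remarks on Weil's quadratic functional in the theory of prime numbers I*,
  Rend. Mat. Acc. Lincei (9) 11 (2000), Thm 2, §3 (mollification). [Bombieri2000Weil]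
* A. Connes, C. Consani, *Spectral triples and ζ-cycles*, arXiv:2106.01715, §2.3 (the semi-local
  form at `λ² = 2, 3`). [ConnesConsani2023]
-/

noncomputable section

open Complex Filter Set MeasureTheory Topology
open scoped Real ComplexConjugate Convolution

namespace Literature.NumberTheory.LFunctions

open Literature.Analysis.SpecialFunctions

variable {g : ℝ → ℂ}

/-! ## 1. The Jensen-type archimedean bound -/

/-- Tangent-line (concavity in `t²`) bound for one term of the vertical series:
`f_l(t) ≤ f_l(τ) + (2l/(l²+τ²)²)(t² − τ²)`. [folklore] -/
theorem digammaTerm_le_tangent {l : ℝ} (hl : 0 < l) (t τ : ℝ) :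
    digammaTerm l t ≤ digammaTerm l τ + 2 * l / (l ^ 2 + τ ^ 2) ^ 2 * (t ^ 2 - τ ^ 2) := by
  have h := digammaTerm_sub hl t τ
  have h1 : 0 < l ^ 2 + t ^ 2 := by positivity
  have h2 : 0 < l ^ 2 + τ ^ 2 := by positivity
  have key : 2 * l * (t ^ 2 - τ ^ 2) / ((l ^ 2 + t ^ 2) * (l ^ 2 + τ ^ 2)) ≤
      2 * l / (l ^ 2 + τ ^ 2) ^ 2 * (t ^ 2 - τ ^ 2) := by
    rw [div_mul_eq_mul_div, div_le_div_iff₀ (by positivity) (by positivity)]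
    have e : 2 * l * (t ^ 2 - τ ^ 2) * ((l ^ 2 + t ^ 2) * (l ^ 2 + τ ^ 2)) -
        2 * l * (t ^ 2 - τ ^ 2) * (l ^ 2 + τ ^ 2) ^ 2 =
        2 * l * (l ^ 2 + τ ^ 2) * (t ^ 2 - τ ^ 2) ^ 2 := by ring
    nlinarith [mul_nonneg (mul_nonneg (by positivity : (0 : ℝ) ≤ 2 * l) h2.le) (sq_nonneg (t ^ 2 - τ ^ 2))]
  linarith

/-- The summands of the tangent slope are dominated: `2l_m/(l_m²+τ²)² ≤ 2/l_m³ ≤ 16/(m+1)²`. [folklore] -/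
theorem jensenSlope_term_le (τ : ℝ) (m : ℕ) :
    2 * digammaNode m / (digammaNode m ^ 2 + τ ^ 2) ^ 2 ≤ 16 * (1 / ((m : ℝ) + 1) ^ 2) := by
  have hl := digammaNode_pos m
  refine le_trans ?_ (two_div_digammaNode_cube_le m)
  rw [div_le_div_iff₀ (by positivity) (by positivity)]
  nlinarith [mul_nonneg (sq_nonneg τ) (by positivity : (0 : ℝ) ≤ 2 * digammaNode m ^ 2 + τ ^ 2),
    pow_pos hl 4]

/-- The tangent slope series is summable. [folklore] -/
theorem summable_jensenSlope_term (τ : ℝ) :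
    Summable fun m : ℕ ↦ 2 * digammaNode m / (digammaNode m ^ 2 + τ ^ 2) ^ 2 :=
  Summable.of_nonneg_of_le (fun m ↦ by have := digammaNode_pos m; positivity)
    (jensenSlope_term_le τ) (hasSum_one_div_nat_add_one_sq.summable.mul_left 16)

/-- The slope `K(τ) = Σ_m 2l_m/(l_m²+τ²)²` of the tangent majorant of `Re ψ(1/4 + it/2)` in the
variable `t²`. [folklore] -/
def jensenSlope (τ : ℝ) : ℝ :=
  ∑' m : ℕ, 2 * digammaNode m / (digammaNode m ^ 2 + τ ^ 2) ^ 2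

/-- `K(τ) ≥ 0`. [folklore] -/
theorem jensenSlope_nonneg (τ : ℝ) : 0 ≤ jensenSlope τ :=
  tsum_nonneg fun m ↦ by have := digammaNode_pos m; positivity

/-- **Concavity of `Re ψ(1/4 + it/2)` in `t²`, tangent form**:
`Re ψ(1/4 + it/2) ≤ Re ψ(1/4 + iτ/2) + K(τ)(t² − τ²)`. [cite: Yoshida1992, §6 (the vertical series); tangent bound folklore] -/
theorem reDigammaQuarter_le_tangent (t τ : ℝ) :
    reDigammaQuarter t ≤ reDigammaQuarter τ + jensenSlope τ * (t ^ 2 - τ ^ 2) := by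
  have h1 := hasSum_digammaTerm t
  have h2 := hasSum_digammaTerm τ
  have h3 : HasSum (fun m : ℕ ↦ 2 * digammaNode m / (digammaNode m ^ 2 + τ ^ 2) ^ 2 * (t ^ 2 - τ ^ 2))
      (jensenSlope τ * (t ^ 2 - τ ^ 2)) :=
    (summable_jensenSlope_term τ).hasSum.mul_right _
  have h4 := hasSum_le (fun m ↦ digammaTerm_le_tangent (digammaNode_pos m) t τ) h1 (h2.add h3)
  linarith

/-- **Plancherel for the derivative**: `∫ t² |ĝ(1/2+it)|² dt = 2π ‖g'‖₂²`
(`(g')^(1/2+it) = −it ĝ(1/2+it)`). [folklore] -/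
theorem integral_sq_mul_norm_sq_weilMellin (hg : IsWeilTest g) :
    ∫ t : ℝ, t ^ 2 * ‖weilMellin g (1 / 2 + t * I)‖ ^ 2 = 2 * π * weilNorm2Sq (deriv g) := by
  rw [← integral_norm_sq_weilMellin_half_line hg.deriv]
  congr 1 with t
  rw [weilMellin_deriv hg]
  have e : -(1 / 2 + (t : ℂ) * I - 1 / 2) = -((t : ℂ) * I) := by ring
  rw [e, norm_mul, norm_neg, norm_mul, Complex.norm_real, Complex.norm_I, mul_one, mul_pow,
    Real.norm_eq_abs, sq_abs]

/-- **Jensen-type archimedean bound.** If `‖g'‖₂² ≤ τ² ‖g‖₂²` then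
`(1/2π) ∫ |ĝ(1/2+it)|² Re ψ(1/4+it/2) dt ≤ Re ψ(1/4 + iτ/2) · ‖g‖₂²`: the archimedean density,
concave in `t²`, is evaluated at the root-mean-square frequency of `g`. [folklore] -/
theorem weilArch_le_of_jensen (hg : IsWeilTest g) {τ : ℝ}
    (hD : weilNorm2Sq (deriv g) ≤ τ ^ 2 * weilNorm2Sq g) :
    1 / (2 * π) * ∫ t : ℝ, ‖weilMellin g (1 / 2 + t * I)‖ ^ 2 * reDigammaQuarter t ≤
      reDigammaQuarter τ * weilNorm2Sq g := by
  have hI1 := integrable_norm_sq_weilMellin_mul_reDigammaQuarter hg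
  have hI0 := integrable_norm_sq_weilMellin_half_line hg
  have hI2 : Integrable fun t : ℝ ↦ ‖weilMellin g (1 / 2 + t * I)‖ ^ 2 * t ^ 2 :=
    integrable_norm_sq_weilMellin_mul hg (measurable_id.pow_const 2) (A := 0) (B := 1) le_rfl
      zero_le_one fun t ↦ by rw [abs_of_nonneg (sq_nonneg t)]; simp
  have hpt : ∀ t : ℝ, ‖weilMellin g (1 / 2 + t * I)‖ ^ 2 * reDigammaQuarter t ≤
      reDigammaQuarter τ * ‖weilMellin g (1 / 2 + t * I)‖ ^ 2 +
        jensenSlope τ * (‖weilMellin g (1 / 2 + t * I)‖ ^ 2 * t ^ 2 -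
          τ ^ 2 * ‖weilMellin g (1 / 2 + t * I)‖ ^ 2) := by
    intro t
    have h := mul_le_mul_of_nonneg_left (reDigammaQuarter_le_tangent t τ)
      (sq_nonneg ‖weilMellin g (1 / 2 + t * I)‖)
    have e : ‖weilMellin g (1 / 2 + t * I)‖ ^ 2 * (reDigammaQuarter τ + jensenSlope τ * (t ^ 2 - τ ^ 2)) =
        reDigammaQuarter τ * ‖weilMellin g (1 / 2 + t * I)‖ ^ 2 +
          jensenSlope τ * (‖weilMellin g (1 / 2 + t * I)‖ ^ 2 * t ^ 2 -
            τ ^ 2 * ‖weilMellin g (1 / 2 + t * I)‖ ^ 2) := by ring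
    linarith
  have hA : Integrable fun t : ℝ ↦ reDigammaQuarter τ * ‖weilMellin g (1 / 2 + t * I)‖ ^ 2 :=
    hI0.const_mul (reDigammaQuarter τ)
  have hB : Integrable fun t : ℝ ↦ jensenSlope τ * (‖weilMellin g (1 / 2 + t * I)‖ ^ 2 * t ^ 2 -
      τ ^ 2 * ‖weilMellin g (1 / 2 + t * I)‖ ^ 2) :=
    (hI2.sub (hI0.const_mul (τ ^ 2))).const_mul (jensenSlope τ)
  have hAB : Integrable fun t : ℝ ↦ reDigammaQuarter τ * ‖weilMellin g (1 / 2 + t * I)‖ ^ 2 +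
      jensenSlope τ * (‖weilMellin g (1 / 2 + t * I)‖ ^ 2 * t ^ 2 -
        τ ^ 2 * ‖weilMellin g (1 / 2 + t * I)‖ ^ 2) := hA.add hB
  have hle := integral_mono hI1 hAB hpt
  have hFt : ∫ t : ℝ, ‖weilMellin g (1 / 2 + t * I)‖ ^ 2 * t ^ 2 = 2 * π * weilNorm2Sq (deriv g) := by
    rw [← integral_sq_mul_norm_sq_weilMellin hg]
    congr 1 with t
    ring
  have hrhs : ∫ t : ℝ, (reDigammaQuarter τ * ‖weilMellin g (1 / 2 + t * I)‖ ^ 2 +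
      jensenSlope τ * (‖weilMellin g (1 / 2 + t * I)‖ ^ 2 * t ^ 2 -
        τ ^ 2 * ‖weilMellin g (1 / 2 + t * I)‖ ^ 2)) =
      reDigammaQuarter τ * (2 * π * weilNorm2Sq g) +
        jensenSlope τ * (2 * π * weilNorm2Sq (deriv g) - τ ^ 2 * (2 * π * weilNorm2Sq g)) := by
    rw [integral_add hA hB, integral_const_mul, integral_const_mul, integral_sub hI2 (hI0.const_mul _),
      integral_const_mul, integral_norm_sq_weilMellin_half_line hg, hFt]
  rw [hrhs] at hle
  have hK := jensenSlope_nonneg τ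
  have hneg : 2 * π * weilNorm2Sq (deriv g) - τ ^ 2 * (2 * π * weilNorm2Sq g) ≤ 0 := by
    nlinarith [Real.pi_pos]
  have hKn := mul_nonpos_iff.2 (Or.inl ⟨hK, hneg⟩)
  rw [div_mul_eq_mul_div, one_mul, div_le_iff₀ (by positivity)]
  linarith

/-! ## 2. The explicit odd witness and its mollification -/

namespace JensenWindow

open WeilContinuous

/-- The half-width `b = 69/100` of the witness (`b < log 2`). [folklore] -/
def b : ℝ := 69 / 100

/-- The frequency `ω = 2π/b` (the lowest `b`-periodic odd mode). [folklore] -/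
def ω : ℝ := 2 * π / b

/-- `b > 0`. [folklore] -/
lemma b_pos : 0 < b := by unfold b; norm_num

/-- `ω > 0`. [folklore] -/
lemma ω_pos : 0 < ω := by unfold ω; exact div_pos (by positivity) b_pos

/-- `ω b = 2π`. [folklore] -/
lemma ω_mul_b : ω * b = 2 * π := by
  unfold ω; field_simp [b_pos.ne']

/-- The clamp `x ↦ max(−b, min(b, x))` onto `[−b, b]`. [folklore] -/
def clamp (x : ℝ) : ℝ := max (-b) (min b x)

/-- `clamp` is the identity on `[-b, b]`. [folklore] -/
lemma clamp_of_mem {x : ℝ} (hx : x ∈ Icc (-b) b) : clamp x = x := by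
  unfold clamp; rw [min_eq_right hx.2, max_eq_right hx.1]

/-- `clamp` is continuous. [folklore] -/
lemma continuous_clamp : Continuous clamp := by unfold clamp; fun_prop

/-- `clamp` is odd. [folklore] -/
lemma clamp_neg (x : ℝ) : clamp (-x) = -clamp x := by
  unfold clamp
  have hb : -b ≤ b := by linarith [b_pos]
  rw [show min b (-x) = -max (-b) x by rw [← min_neg_neg, neg_neg],
    show max (-b) (-max (-b) x) = -min b (max (-b) x) by rw [← max_neg_neg],
    max_min_distrib_left, max_eq_right hb]

/-- **The witness** `G(x) = sin(ω · clamp x)`: equal to `sin(2πx/b)` on `[−b, b]` and to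
`sin(±2π) = 0` outside; continuous, odd, `|G| ≤ 1`. [folklore] -/
def G (x : ℝ) : ℂ := ((Real.sin (ω * clamp x) : ℝ) : ℂ)

/-- `G` is continuous. [folklore] -/
lemma continuous_G : Continuous G := by
  unfold G; exact Complex.continuous_ofReal.comp ((Real.continuous_sin.comp (continuous_const.mul continuous_clamp)))

/-- `G = sin(ω·)` on `[-b, b]`. [folklore] -/
lemma G_of_mem {x : ℝ} (hx : x ∈ Icc (-b) b) : G x = ((Real.sin (ω * x) : ℝ) : ℂ) := by
  rw [G, clamp_of_mem hx]

/-- `G = 0` off `[-b, b]`. [folklore] -/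
lemma G_eq_zero {x : ℝ} (hx : x ∉ Icc (-b) b) : G x = 0 := by
  unfold G clamp
  rw [mem_Icc, not_and_or, not_le, not_le] at hx
  rcases hx with h | h
  · have : max (-b) (min b x) = -b := by
      rw [min_eq_right (by linarith [b_pos]), max_eq_left h.le]
    rw [this, mul_neg, ω_mul_b, Real.sin_neg, Real.sin_two_pi]; simp
  · have : max (-b) (min b x) = b := by
      rw [min_eq_left h.le, max_eq_right (by linarith [b_pos])]
    rw [this, ω_mul_b, Real.sin_two_pi]; simp

/-- `G x = 0` for `|x| > b`. [folklore] -/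
lemma G_eq_zero_of_lt {x : ℝ} (hx : b < |x|) : G x = 0 := by
  refine G_eq_zero fun h ↦ ?_
  have := abs_le.2 ⟨h.1, h.2⟩
  linarith

/-- `G` has compact support. [folklore] -/
lemma hasCompactSupport_G : HasCompactSupport G :=
  HasCompactSupport.intro isCompact_Icc fun _ hx ↦ G_eq_zero hx

/-- `G` is odd. [folklore] -/
lemma G_neg (x : ℝ) : G (-x) = -G x := by
  unfold G; rw [clamp_neg, mul_neg, Real.sin_neg]; push_cast; ring

/-- `|G| ≤ 1`. [folklore] -/
lemma norm_G_le (x : ℝ) : ‖G x‖ ≤ 1 := by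
  unfold G; rw [Complex.norm_real, Real.norm_eq_abs]; exact Real.abs_sin_le_one _

/-- The mollifier is even. [folklore] -/
lemma moll_neg (k : ℕ) (y : ℝ) : moll k (-y) = moll k y := by
  unfold moll; rw [ContDiffBump.normed_neg]

/-- **The mollified witnesses** `g_k = G ⋆ φ_k` (test functions). [cite: Bombieri2000Weil, §3 (mollification)] -/
def gk (k : ℕ) : ℝ → ℂ := weilConv G (moll k)

/-- `g_k` is a test function. [cite: Bombieri2000Weil, §3 (mollification)] -/
lemma isWeilTest_gk (k : ℕ) : IsWeilTest (gk k) :=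
  isWeilTest_weilConv_moll continuous_G hasCompactSupport_G k

/-- `g_k` is odd. [folklore] -/
lemma gk_neg (k : ℕ) (x : ℝ) : gk k (-x) = -gk k x := by
  simp only [gk, weilConv_apply]
  rw [← integral_neg, ← integral_neg_eq_self (fun u ↦ G u * moll k (-x - u)) volume]
  congr 1 with u
  rw [G_neg, show -x - -u = -(x - u) by ring, moll_neg]
  ring

/-- `|g_k| ≤ 1`. [folklore] -/
lemma norm_gk_le (k : ℕ) (x : ℝ) : ‖gk k x‖ ≤ 1 := by
  rw [gk, weilConv_apply]
  calc ‖∫ u, G u * moll k (x - u)‖ ≤ ∫ u, ‖G u * moll k (x - u)‖ := norm_integral_le_integral_norm _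
    _ ≤ ∫ u, ‖moll k (x - u)‖ := by
        refine integral_mono_of_nonneg (Eventually.of_forall fun _ ↦ norm_nonneg _)
          ((integrable_norm_moll k).comp_sub_left x) (Eventually.of_forall fun u ↦ ?_)
        dsimp only
        rw [norm_mul]
        exact mul_le_of_le_one_left (norm_nonneg _) (norm_G_le u)
    _ = 1 := by
        rw [integral_sub_left_eq_self (fun u ↦ ‖moll k u‖) volume x]; exact integral_norm_moll k

/-- `g_k(x) = 0` for `|x| > b + 1/(k+1)`. [folklore] -/
lemma gk_eq_zero {k : ℕ} {x : ℝ} (hx : b + (bump k).rOut < |x|) : gk k x = 0 := by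
  rw [gk, weilConv_apply]
  refine integral_eq_zero_of_ae (Eventually.of_forall fun u ↦ ?_)
  simp only [Pi.zero_apply]
  rcases le_or_gt (bump k).rOut |x - u| with hu | hu
  · rw [moll_eq_zero hu, mul_zero]
  · have h2 : b < |u| := by
      have := abs_sub_abs_le_abs_sub x u
      linarith
    rw [G_eq_zero_of_lt h2, zero_mul]

/-- `tsupport g_k ⊆ [−(b + 1/(k+1)), b + 1/(k+1)]`. [folklore] -/
lemma tsupport_gk_subset (k : ℕ) :
    tsupport (gk k) ⊆ Icc (-(b + (bump k).rOut)) (b + (bump k).rOut) := by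
  refine closure_minimal (fun x hx ↦ ?_) isClosed_Icc
  rw [Function.mem_support] at hx
  by_contra h
  exact hx (gk_eq_zero (by
    rw [mem_Icc, not_and_or, not_le, not_le] at h
    rcases h with h | h
    · rw [abs_of_neg (by linarith [b_pos, (bump k).rOut_pos])]; linarith
    · rw [abs_of_pos (by linarith [b_pos, (bump k).rOut_pos])]; linarith))

/-- For `k ≥ 399` the support of `g_k` lies in `[−log 2, log 2]` (`b + 1/400 ≤ log 2`). [folklore] -/
lemma tsupport_gk_subset_log_two {k : ℕ} (hk : 399 ≤ k) :
    tsupport (gk k) ⊆ Icc (-Real.log 2) (Real.log 2) := by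
  have hr : b + (bump k).rOut ≤ Real.log 2 := by
    rw [bump_rOut]
    have hk' : (400 : ℝ) ≤ (k : ℝ) + 1 := by exact_mod_cast Nat.succ_le_succ hk
    have h1 : 1 / ((k : ℝ) + 1) ≤ 1 / 400 := one_div_le_one_div_of_le (by norm_num) hk'
    have h2 := Real.log_two_gt_d9
    unfold b; linarith
  exact (tsupport_gk_subset k).trans (Icc_subset_Icc (by linarith) hr)

/-! ### The derivative of the mollification: `‖g_k'‖₂² ≤ ω² b` -/

/-- The derivative profile `H(u) = ω cos(ωu)` (`= G'` on `(−b, b)`). [folklore] -/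
def H (u : ℝ) : ℝ := ω * Real.cos (ω * u)

/-- `H` is continuous. [folklore] -/
lemma continuous_H : Continuous H := by unfold H; fun_prop

/-- Differentiation under the convolution: `g_k' = G ⋆ φ_k'`. [folklore] -/
lemma hasDerivAt_gk (k : ℕ) (x : ℝ) :
    HasDerivAt (gk k) (weilConv G (deriv (moll k)) x) x := by
  have h := HasCompactSupport.hasDerivAt_convolution_right (ContinuousLinearMap.mul ℝ ℂ)
    (μ := volume) (continuous_G.locallyIntegrable) (hasCompactSupport_moll k)
    ((contDiff_moll k).of_le (by simp)) x
  rw [← weilConv_eq_convolution_real, ← weilConv_eq_convolution_real] at h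
  exact h

/-- `g_k' = G ⋆ φ_k'` as functions. [folklore] -/
lemma deriv_gk (k : ℕ) : deriv (gk k) = fun x ↦ weilConv G (deriv (moll k)) x :=
  funext fun x ↦ (hasDerivAt_gk k x).deriv

/-- One integration by parts: `(G ⋆ φ_k')(x) = ∫_{-b}^{b} H(u) φ_k(x − u) du` (the boundary terms
vanish because `G(±b) = sin(±2π) = 0`). [folklore] -/
lemma weilConv_G_deriv_moll (k : ℕ) (x : ℝ) :
    weilConv G (deriv (moll k)) x = ∫ u in (-b)..b, ((H u : ℝ) : ℂ) * moll k (x - u) := by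
  have hb : -b ≤ b := by linarith [b_pos]
  rw [weilConv_apply]
  have h1 : ∫ u, G u * deriv (moll k) (x - u) =
      ∫ u in (-b)..b, ((Real.sin (ω * u) : ℝ) : ℂ) * deriv (moll k) (x - u) := by
    rw [intervalIntegral.integral_of_le hb, ← integral_Icc_eq_integral_Ioc,
      ← setIntegral_eq_integral_of_forall_compl_eq_zero (s := Icc (-b) b)
        (fun u hu ↦ by rw [G_eq_zero hu, zero_mul])]
    refine setIntegral_congr_fun measurableSet_Icc fun u hu ↦ ?_
    simp only [G_of_mem hu]
  rw [h1]
  have hu : ∀ y ∈ uIcc (-b) b,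
      HasDerivAt (fun y : ℝ ↦ ((Real.sin (ω * y) : ℝ) : ℂ)) (((H y : ℝ) : ℂ)) y := by
    intro y _
    have h := ((Real.hasDerivAt_sin (ω * y)).comp y ((hasDerivAt_id y).const_mul ω)).ofReal_comp
    have e : ((Real.cos (ω * y) * (ω * 1) : ℝ) : ℂ) = ((H y : ℝ) : ℂ) := by
      unfold H; push_cast; ring
    rw [e] at h
    exact h
  have hv : ∀ y ∈ uIcc (-b) b,
      HasDerivAt (fun y : ℝ ↦ -moll k (x - y)) (deriv (moll k) (x - y)) y := by
    intro y _
    have hm : HasDerivAt (moll k) (deriv (moll k) (x - y)) (x - y) :=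
      (((contDiff_moll k).differentiable (by simp)).differentiableAt).hasDerivAt
    have hc : HasDerivAt (fun y : ℝ ↦ x - y) (-1) y := by
      simpa using (hasDerivAt_id y).const_sub x
    have h := (hm.scomp y hc).neg
    have e : -((-1 : ℝ) • deriv (moll k) (x - y)) = deriv (moll k) (x - y) := by
      rw [neg_one_smul, neg_neg]
    rw [e] at h
    exact h
  have hu' : IntervalIntegrable (fun y : ℝ ↦ ((H y : ℝ) : ℂ)) volume (-b) b :=
    (Complex.continuous_ofReal.comp continuous_H).intervalIntegrable _ _
  have hv' : IntervalIntegrable (fun y : ℝ ↦ deriv (moll k) (x - y)) volume (-b) b :=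
    (((contDiff_moll k).continuous_deriv (by simp)).comp
      (continuous_const.sub continuous_id)).intervalIntegrable _ _
  have key := intervalIntegral.integral_mul_deriv_eq_deriv_mul hu hv hu' hv'
  rw [key]
  have hsb : Real.sin (ω * b) = 0 := by rw [ω_mul_b]; exact Real.sin_two_pi
  have hsnb : Real.sin (ω * -b) = 0 := by rw [mul_neg, Real.sin_neg, hsb, neg_zero]
  simp [hsb, intervalIntegral.integral_neg]

/-- Cauchy–Schwarz: `|(G ⋆ φ_k')(x)|² ≤ ∫_{-b}^{b} H(u)² |φ_k(x − u)| du` (`∫ |φ_k| = 1`). [folklore] -/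
lemma norm_sq_weilConv_G_deriv_moll_le (k : ℕ) (x : ℝ) :
    ‖weilConv G (deriv (moll k)) x‖ ^ 2 ≤ ∫ u in (-b)..b, H u ^ 2 * ‖moll k (x - u)‖ := by
  have hb : -b ≤ b := by linarith [b_pos]
  rw [weilConv_G_deriv_moll]
  set B := ∫ u in (-b)..b, |H u| * ‖moll k (x - u)‖ with hB
  set A := ∫ u in (-b)..b, H u ^ 2 * ‖moll k (x - u)‖ with hA
  set W := ∫ u in (-b)..b, ‖moll k (x - u)‖ with hW
  have hcm : Continuous fun u : ℝ ↦ ‖moll k (x - u)‖ :=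
    ((continuous_moll k).comp (continuous_const.sub continuous_id)).norm
  have hW1 : W ≤ 1 := by
    rw [hW, intervalIntegral.integral_of_le hb]
    calc ∫ u in Ioc (-b) b, ‖moll k (x - u)‖ ≤ ∫ u, ‖moll k (x - u)‖ :=
          setIntegral_le_integral ((integrable_norm_moll k).comp_sub_left x)
            (Eventually.of_forall fun _ ↦ norm_nonneg _)
      _ = 1 := by
          rw [integral_sub_left_eq_self (fun u ↦ ‖moll k u‖) volume x]; exact integral_norm_moll k
  have h1 : ‖∫ u in (-b)..b, ((H u : ℝ) : ℂ) * moll k (x - u)‖ ≤ B := by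
    refine (intervalIntegral.norm_integral_le_integral_norm hb).trans_eq ?_
    rw [hB]
    refine intervalIntegral.integral_congr fun u _ ↦ ?_
    simp only [norm_mul, Complex.norm_real, Real.norm_eq_abs]
  have h2 : B * B ≤ (A + B ^ 2 * W) / 2 := by
    have e1 : B * B = ∫ u in (-b)..b, B * (|H u| * ‖moll k (x - u)‖) := by
      rw [intervalIntegral.integral_const_mul]
    have e2 : (A + B ^ 2 * W) / 2 =
        ∫ u in (-b)..b, (H u ^ 2 * ‖moll k (x - u)‖ + B ^ 2 * ‖moll k (x - u)‖) / 2 := by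
      rw [intervalIntegral.integral_div, intervalIntegral.integral_add,
        intervalIntegral.integral_const_mul]
      · exact ((continuous_H.pow 2).mul hcm).intervalIntegrable _ _
      · exact (continuous_const.mul hcm).intervalIntegrable _ _
    rw [e1, e2]
    refine intervalIntegral.integral_mono_on hb ?_ ?_ fun u _ ↦ ?_
    · exact (continuous_const.mul ((continuous_H.abs).mul hcm)).intervalIntegrable _ _
    · exact ((((continuous_H.pow 2).mul hcm).add (continuous_const.mul hcm)).div_const _).intervalIntegrable _ _
    · have hm0 : 0 ≤ ‖moll k (x - u)‖ := norm_nonneg _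
      have hsq : |H u| ^ 2 = H u ^ 2 := sq_abs _
      nlinarith [mul_nonneg (sq_nonneg (|H u| - B)) hm0]
  have h3 : ‖∫ u in (-b)..b, ((H u : ℝ) : ℂ) * moll k (x - u)‖ ^ 2 ≤ B ^ 2 :=
    pow_le_pow_left₀ (norm_nonneg _) h1 2
  nlinarith [mul_le_mul_of_nonneg_left hW1 (sq_nonneg B)]

/-- The Cauchy–Schwarz majorant as a convolution of `1_{[-b,b]} H²` with `|φ_k|`. [folklore] -/
lemma intervalIntegral_H_sq_eq_convolution (k : ℕ) (x : ℝ) :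
    ∫ u in (-b)..b, H u ^ 2 * ‖moll k (x - u)‖ =
      ((Icc (-b) b).indicator (fun u ↦ H u ^ 2) ⋆[ContinuousLinearMap.mul ℝ ℝ, volume]
        (fun y ↦ ‖moll k y‖)) x := by
  have hb : -b ≤ b := by linarith [b_pos]
  rw [convolution_mul, intervalIntegral.integral_of_le hb, ← integral_Icc_eq_integral_Ioc,
    ← integral_indicator measurableSet_Icc]
  congr 1 with u
  rw [Set.indicator_mul_left]

/-- `∫_{-b}^{b} H² = ω² b` (`∫_{-2π}^{2π} cos² = 2π`). [folklore] -/
lemma integral_H_sq : ∫ u in (-b)..b, H u ^ 2 = ω ^ 2 * b := by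
  have hω := ω_pos
  simp only [H, mul_pow]
  rw [intervalIntegral.integral_const_mul,
    show (∫ u in (-b)..b, Real.cos (ω * u) ^ 2) = ω⁻¹ • ∫ u in ω * -b..ω * b, Real.cos u ^ 2 from
      intervalIntegral.integral_comp_mul_left (fun v ↦ Real.cos v ^ 2) hω.ne',
    integral_cos_sq, show ω * -b = -(2 * π) by rw [mul_neg, ω_mul_b], ω_mul_b]
  rw [Real.cos_neg, Real.sin_neg, Real.sin_two_pi, Real.cos_two_pi]
  have e : ω * b = 2 * π := ω_mul_b
  simp only [mul_zero, neg_zero, sub_zero, smul_eq_mul]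
  field_simp
  nlinarith [e]

/-- Integrability of `1_{[-b,b]} H²`. [folklore] -/
lemma integrable_indicator_H_sq : Integrable ((Icc (-b) b).indicator fun u ↦ H u ^ 2) :=
  ((continuous_H.pow 2).integrableOn_Icc).integrable_indicator measurableSet_Icc

/-- `∫ 1_{[-b,b]} H² = ω² b`. [folklore] -/
lemma integral_indicator_H_sq : ∫ u, (Icc (-b) b).indicator (fun u ↦ H u ^ 2) u = ω ^ 2 * b := by
  rw [integral_indicator measurableSet_Icc, integral_Icc_eq_integral_Ioc,
    ← intervalIntegral.integral_of_le (by linarith [b_pos]), integral_H_sq]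

/-- `‖f‖²` is integrable for a test function. [folklore] -/
lemma integrable_norm_sq_of_isWeilTest {f : ℝ → ℂ} (hf : IsWeilTest f) :
    Integrable fun x ↦ ‖f x‖ ^ 2 :=
  (hf.1.continuous.memLp_of_hasCompactSupport (p := 2) hf.2).integrable_norm_pow two_ne_zero

/-- **Derivative bound for the mollified witness**: `‖g_k'‖₂² ≤ ‖G'‖₂² = ω² b`. [folklore] -/
theorem weilNorm2Sq_deriv_gk_le (k : ℕ) : weilNorm2Sq (deriv (gk k)) ≤ ω ^ 2 * b := by
  have hi1 : Integrable fun x ↦ ‖deriv (gk k) x‖ ^ 2 :=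
    integrable_norm_sq_of_isWeilTest (isWeilTest_gk k).deriv
  have hi2 : Integrable ((Icc (-b) b).indicator (fun u ↦ H u ^ 2) ⋆[ContinuousLinearMap.mul ℝ ℝ, volume]
      (fun y ↦ ‖moll k y‖)) :=
    integrable_indicator_H_sq.integrable_convolution _ (integrable_norm_moll k)
  have hle : ∀ x, ‖deriv (gk k) x‖ ^ 2 ≤ ((Icc (-b) b).indicator (fun u ↦ H u ^ 2) ⋆[ContinuousLinearMap.mul ℝ ℝ, volume]
      (fun y ↦ ‖moll k y‖)) x := fun x ↦ by
    rw [deriv_gk, ← intervalIntegral_H_sq_eq_convolution]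
    exact norm_sq_weilConv_G_deriv_moll_le k x
  unfold weilNorm2Sq
  refine (integral_mono hi1 hi2 hle).trans_eq ?_
  rw [integral_convolution _ integrable_indicator_H_sq (integrable_norm_moll k),
    integral_indicator_H_sq, integral_norm_moll]
  simp

/-! ### Limits of the mollification: `‖g_k‖₂² → b` and `k_{g_k}(±log 2) → P` -/

/-- `‖G‖₂² = b` (`∫_{-b}^{b} sin²(2πx/b) dx = b`). [folklore] -/
lemma weilNorm2Sq_G : weilNorm2Sq G = b := by
  have hb : -b ≤ b := by linarith [b_pos]
  have hω := ω_pos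
  unfold weilNorm2Sq
  rw [← setIntegral_eq_integral_of_forall_compl_eq_zero (s := Icc (-b) b)
      (fun x hx ↦ by rw [G_eq_zero hx, norm_zero, zero_pow two_ne_zero]),
    integral_Icc_eq_integral_Ioc, ← intervalIntegral.integral_of_le hb]
  have e : EqOn (fun x ↦ ‖G x‖ ^ 2) (fun x ↦ Real.sin (ω * x) ^ 2) (uIcc (-b) b) := by
    intro x hx
    rw [uIcc_of_le hb] at hx
    simp only [G_of_mem hx, Complex.norm_real, Real.norm_eq_abs, sq_abs]
  rw [intervalIntegral.integral_congr e,
    show (∫ x in (-b)..b, Real.sin (ω * x) ^ 2) = ω⁻¹ • ∫ x in ω * -b..ω * b, Real.sin x ^ 2 from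
      intervalIntegral.integral_comp_mul_left (fun v ↦ Real.sin v ^ 2) hω.ne',
    integral_sin_sq, show ω * -b = -(2 * π) by rw [mul_neg, ω_mul_b], ω_mul_b]
  rw [Real.sin_neg, Real.cos_neg, Real.sin_two_pi, Real.cos_two_pi]
  have e : ω * b = 2 * π := ω_mul_b
  simp only [neg_zero, zero_mul, sub_zero, smul_eq_mul, sub_neg_eq_add]
  field_simp
  nlinarith [e]

/-- The dominating function for the dominated-convergence arguments. [folklore] -/
lemma integrable_indicator_one :
    Integrable ((Icc (-(b + 1)) (b + 1)).indicator fun _ : ℝ ↦ (1 : ℝ)) :=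
  (continuous_const.integrableOn_Icc).integrable_indicator measurableSet_Icc

/-- `g_k x = 0` for `|x| > b + 1`. [folklore] -/
lemma gk_eq_zero_of_lt {k : ℕ} {x : ℝ} (hx : b + 1 < |x|) : gk k x = 0 :=
  gk_eq_zero (lt_of_le_of_lt (by linarith [bump_rOut_le_one k]) hx)

/-- `x ∉ [-c, c] ⇒ c < |x|`. [folklore] -/
lemma lt_abs_of_not_mem {c x : ℝ} (hx : x ∉ Icc (-c) c) : c < |x| := by
  rw [mem_Icc, not_and_or, not_le, not_le] at hx
  rcases hx with h | h
  · rcases le_or_gt 0 x with h' | h'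
    · rw [abs_of_nonneg h']; linarith
    · rw [abs_of_neg h']; linarith
  · exact lt_of_lt_of_le h (le_abs_self x)

/-- `‖g_k‖₂² → ‖G‖₂² = b` (dominated convergence, `|g_k| ≤ 1` on `[-b-1, b+1]`). [folklore] -/
lemma tendsto_weilNorm2Sq_gk : Tendsto (fun k ↦ weilNorm2Sq (gk k)) atTop (𝓝 b) := by
  rw [← weilNorm2Sq_G]
  unfold weilNorm2Sq
  refine tendsto_integral_of_dominated_convergence
    ((Icc (-(b + 1)) (b + 1)).indicator fun _ : ℝ ↦ (1 : ℝ))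
    (fun k ↦ ((isWeilTest_gk k).1.continuous.norm.pow 2).aestronglyMeasurable)
    integrable_indicator_one (fun k ↦ Eventually.of_forall fun x ↦ ?_)
    (Eventually.of_forall fun x ↦ ((tendsto_weilConv_moll continuous_G x).norm.pow 2))
  rw [Real.norm_eq_abs, abs_of_nonneg (by positivity)]
  by_cases hx : x ∈ Icc (-(b + 1)) (b + 1)
  · rw [indicator_of_mem hx]
    have h := norm_gk_le k x
    nlinarith [norm_nonneg (gk k x)]
  · rw [indicator_of_notMem hx, gk_eq_zero_of_lt (lt_abs_of_not_mem hx), norm_zero,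
      zero_pow two_ne_zero]

/-- The spike values converge: `k_{g_k}(y) → k_G(y)`. [folklore] -/
lemma tendsto_weilConv_weilReflect_gk (y : ℝ) :
    Tendsto (fun k ↦ weilConv (gk k) (weilReflect (gk k)) y) atTop
      (𝓝 (weilConv G (weilReflect G) y)) := by
  simp only [weilConv_apply, weilReflect]
  refine tendsto_integral_of_dominated_convergence
    ((Icc (-(b + 1)) (b + 1)).indicator fun _ : ℝ ↦ (1 : ℝ))
    (fun k ↦ ?_) integrable_indicator_one (fun k ↦ Eventually.of_forall fun u ↦ ?_)
    (Eventually.of_forall fun u ↦ ?_)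
  · exact (((isWeilTest_gk k).1.continuous).mul (Complex.continuous_conj.comp
      (((isWeilTest_gk k).1.continuous).comp (continuous_const.sub continuous_id).neg))).aestronglyMeasurable
  · rw [norm_mul, Complex.norm_conj]
    by_cases hu : u ∈ Icc (-(b + 1)) (b + 1)
    · rw [indicator_of_mem hu]
      exact mul_le_one₀ (norm_gk_le k u) (norm_nonneg _) (norm_gk_le k _)
    · rw [indicator_of_notMem hu, gk_eq_zero_of_lt (lt_abs_of_not_mem hu), norm_zero, zero_mul]
  · exact (tendsto_weilConv_moll continuous_G u).mul
      ((Complex.continuous_conj.tendsto _).comp (tendsto_weilConv_moll continuous_G (-(y - u))))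

/-- The limit spike value `P = k_G(log 2) = ½(2b − log 2)cos(ω log 2) + sin(ω log 2)/(2ω)`. [folklore] -/
def P : ℝ :=
  (2 * b - Real.log 2) * Real.cos (ω * Real.log 2) / 2 + Real.sin (ω * Real.log 2) / (2 * ω)

/-- `G` is real-valued. [folklore] -/
lemma conj_G (t : ℝ) : conj (G t) = G t := by unfold G; exact Complex.conj_ofReal _

/-- Closed form of the limit spike value at `log 2`. [folklore] -/
lemma weilConv_G_weilReflect_G_log_two : weilConv G (weilReflect G) (Real.log 2) = (P : ℂ) := by
  set y := Real.log 2 with hy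
  have hyb : y < 2 * b := by have := Real.log_two_lt_d9; simp only [b]; linarith
  have hy0 : 0 < y := Real.log_pos one_lt_two
  have hω := ω_pos
  have hbpos := b_pos
  rw [weilConv_apply]
  simp only [weilReflect, neg_sub, conj_G]
  have hle : y - b ≤ b := by linarith
  have hzero : ∀ u ∉ Icc (y - b) b, G u * G (u - y) = 0 := by
    intro u hu
    rw [mem_Icc, not_and_or, not_le, not_le] at hu
    rcases hu with h | h
    · rw [G_eq_zero_of_lt (x := u - y) (by rw [abs_of_neg (by linarith)]; linarith), mul_zero]
    · rw [G_eq_zero_of_lt (x := u) (by rw [abs_of_pos (by linarith)]; linarith), zero_mul]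
  rw [← setIntegral_eq_integral_of_forall_compl_eq_zero (s := Icc (y - b) b) hzero,
    integral_Icc_eq_integral_Ioc, ← intervalIntegral.integral_of_le hle]
  have e : EqOn (fun u ↦ G u * G (u - y))
      (fun u ↦ ((Real.sin (ω * u) * Real.sin (ω * (u - y)) : ℝ) : ℂ)) (uIcc (y - b) b) := by
    intro u hu
    rw [uIcc_of_le hle] at hu
    have hu1 : u ∈ Icc (-b) b := ⟨by linarith [hu.1], hu.2⟩
    have hu2 : u - y ∈ Icc (-b) b := ⟨by linarith [hu.1], by linarith [hu.2]⟩
    simp only [G_of_mem hu1, G_of_mem hu2]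
    push_cast
    ring
  rw [intervalIntegral.integral_congr e, intervalIntegral.integral_ofReal]
  congr 1
  have hderiv : ∀ u ∈ uIcc (y - b) b,
      HasDerivAt (fun u ↦ (u * Real.cos (ω * y) - Real.sin (2 * ω * u - ω * y) / (2 * ω)) / 2)
        (Real.sin (ω * u) * Real.sin (ω * (u - y))) u := by
    intro u _
    have h1 : HasDerivAt (fun u ↦ u * Real.cos (ω * y)) (Real.cos (ω * y)) u := by
      simpa using (hasDerivAt_id u).mul_const (Real.cos (ω * y))
    have h2 : HasDerivAt (fun u ↦ Real.sin (2 * ω * u - ω * y))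
        (Real.cos (2 * ω * u - ω * y) * (2 * ω)) u := by
      have h := ((hasDerivAt_id u).const_mul (2 * ω)).sub_const (ω * y)
      simp only [mul_one] at h
      exact (Real.hasDerivAt_sin _).comp u h
    have h := (h1.sub (h2.div_const (2 * ω))).div_const 2
    have hps : Real.sin (ω * u) * Real.sin (ω * (u - y)) =
        (Real.cos (ω * y) - Real.cos (2 * ω * u - ω * y) * (2 * ω) / (2 * ω)) / 2 := by
      rw [mul_div_assoc, div_self (by positivity : (2 * ω : ℝ) ≠ 0), mul_one,
        show ω * y = ω * u - ω * (u - y) by ring,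
        show 2 * ω * u - (ω * u - ω * (u - y)) = ω * u + ω * (u - y) by ring,
        Real.cos_sub, Real.cos_add]
      ring
    rw [hps]
    exact h
  rw [intervalIntegral.integral_eq_sub_of_hasDerivAt hderiv
    ((by fun_prop : Continuous fun u ↦ Real.sin (ω * u) * Real.sin (ω * (u - y))).intervalIntegrable _ _)]
  have e1 : 2 * ω * b - ω * y = (2 : ℕ) * (2 * π) - ω * y := by push_cast; linarith [ω_mul_b]
  have e2 : 2 * ω * (y - b) - ω * y = ω * y - (2 : ℕ) * (2 * π) := by push_cast; linarith [ω_mul_b]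
  rw [e1, e2, Real.sin_nat_mul_two_pi_sub, Real.sin_sub_nat_mul_two_pi]
  unfold P
  field_simp
  ring

/-- `k_G` is even (`G` is real). [folklore] -/
lemma weilConv_G_weilReflect_G_neg (y : ℝ) :
    weilConv G (weilReflect G) (-y) = weilConv G (weilReflect G) y := by
  simp only [weilConv_apply, weilReflect, neg_sub, conj_G]
  rw [← integral_add_right_eq_self (μ := volume) (fun u ↦ G u * G (u - y)) y]
  congr 1 with u
  rw [add_sub_cancel_right, mul_comm]
  congr 2
  ring

/-- **Lower bound for the limit spike value**: `P > 0.343`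
(`ω log 2 = 2π + ε`, `0 ≤ ε ≤ 0.0287`, `cos ε ≥ 1 − ε²/2`, `sin ε ≥ 0`). [folklore] -/
lemma P_gt : (0.343 : ℝ) < P := by
  have hω := ω_pos
  have hl1 := Real.log_two_gt_d9
  have hl2 := Real.log_two_lt_d9
  have hπ2 := Real.pi_lt_d6
  set ε := ω * Real.log 2 - 2 * π with hε
  have hεeq : ε = ω * (Real.log 2 - b) := by rw [hε, mul_sub, ω_mul_b]
  have hωle : ω ≤ 9.10607 := by
    unfold ω b
    rw [div_le_iff₀ (by norm_num)]
    linarith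
  have hε0 : 0 ≤ ε := by
    rw [hεeq]; exact mul_nonneg hω.le (by simp only [b]; linarith)
  have hε1 : ε ≤ 0.02866 := by
    rw [hεeq]
    have h := mul_le_mul hωle (show Real.log 2 - b ≤ 0.0031471808 by simp only [b]; linarith)
      (by simp only [b]; linarith) (by norm_num : (0:ℝ) ≤ 9.10607)
    linarith
  have hcos : 0.99958 ≤ Real.cos (ω * Real.log 2) := by
    rw [show ω * Real.log 2 = ε + 2 * π by rw [hε]; ring, Real.cos_add_two_pi]
    have h := Real.one_sub_sq_div_two_le_cos (x := ε)
    nlinarith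
  have hsin : 0 ≤ Real.sin (ω * Real.log 2) := by
    rw [show ω * Real.log 2 = ε + 2 * π by rw [hε]; ring, Real.sin_add_two_pi]
    exact Real.sin_nonneg_of_nonneg_of_le_pi hε0 (by linarith [Real.pi_gt_d6])
  unfold P
  have h2b : (0.6868 : ℝ) ≤ 2 * b - Real.log 2 := by simp only [b]; linarith
  have h3 : 0 ≤ Real.sin (ω * Real.log 2) / (2 * ω) := by positivity
  nlinarith [mul_le_mul h2b hcos (by norm_num) (by linarith)]

/-! ### Numerical constants -/

/-- `Re ψ(1/4 + (23/5) i) ≤ 1.5358` (second-order Stirling bound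
`Complex.abs_re_digamma_sub_log_norm_add_re_le` + kernel enclosures of `log 8489`, `log 400`;
true value `1.5296…`). [folklore] -/
lemma reDigammaQuarter_le_d4 : reDigammaQuarter (46 / 5) ≤ 1.5358 := by
  unfold reDigammaQuarter
  have hw : (1 / 4 + ((46 / 5 : ℝ) : ℂ) / 2 * I) = (((1 / 4 : ℝ) : ℂ) + ((23 / 5 : ℝ) : ℂ) * I) := by
    push_cast; ring
  rw [hw]
  set w : ℂ := ((1 / 4 : ℝ) : ℂ) + ((23 / 5 : ℝ) : ℂ) * I with hwdef
  have hre : w.re = 1 / 4 := by simp [hwdef]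
  have him : w.im = 23 / 5 := by simp [hwdef]
  have h := Complex.abs_re_digamma_sub_log_norm_add_re_le (w := w) (by rw [hre]; norm_num)
    (by rw [him]; norm_num)
  rw [him, abs_of_pos (by norm_num : (0:ℝ) < 23 / 5)] at h
  have hnorm : ‖w‖ = Real.sqrt (8489 / 400) := by
    rw [hwdef, Complex.norm_add_mul_I]; norm_num
  have hlog : Real.log ‖w‖ ≤ 1.52754 := by
    rw [hnorm, Real.log_sqrt (by norm_num), Real.log_div (by norm_num) (by norm_num)]
    have h1 : Literature.Analysis.SpecialFunctions.KernelLog.logIv 8489 =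
        some (10936579447644911663339426, 10936579447645387269645692) := by decide +kernel
    have h2 : Literature.Analysis.SpecialFunctions.KernelLog.logIv 400 =
        some (7243236188304272311844207, 7243236188304747917957041) := by decide +kernel
    have hA := (Literature.Analysis.SpecialFunctions.KernelLog.logIv_sound h1).2
    have hB := (Literature.Analysis.SpecialFunctions.KernelLog.logIv_sound h2).1
    norm_num at hA hB ⊢
    linarith
  have hinv : (1 / (2 * w)).re = 50 / 8489 := by
    rw [hwdef, one_div, Complex.inv_re]
    simp [Complex.normSq_apply]
    norm_num
  have hb := (abs_le.1 h).2
  rw [hinv] at hb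
  have hπ := Real.pi_lt_d6
  have hBd : 1 / (6 * (23 / 5 : ℝ) ^ 3) + π / (12 * (23 / 5 : ℝ) ^ 2) ≤ 0.0140847 := by
    rw [show π / (12 * (23 / 5 : ℝ) ^ 2) = π * (25 / 6348) by ring]
    norm_num
    linarith
  linarith

/-- `log π ≥ 1.14472` (kernel enclosures of `log 3141592`, `log 10`). [folklore] -/
lemma log_pi_ge_d5 : (1.14472 : ℝ) ≤ Real.log π := by
  have h1 : Literature.Analysis.SpecialFunctions.KernelLog.logIv 3141592 =
      some (18085820688659230656150083, 18085820688659706262891571) := by decide +kernel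
  have h2 : Literature.Analysis.SpecialFunctions.KernelLog.logIv 10 =
      some (2783654570780016011168420, 2783654570780491616991106) := by decide +kernel
  have hA := (Literature.Analysis.SpecialFunctions.KernelLog.logIv_sound h1).1
  have hB := (Literature.Analysis.SpecialFunctions.KernelLog.logIv_sound h2).2
  have hπ := Real.pi_gt_d6
  have hlog : Real.log (3141592 : ℝ) - 6 * Real.log 10 ≤ Real.log π := by
    have e : (3141592 : ℝ) = 3.141592 * (10 : ℝ) ^ 6 := by norm_num
    rw [e, Real.log_mul (by norm_num) (by norm_num), Real.log_pow]
    push_cast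
    have := Real.log_le_log (by norm_num) hπ.le
    linarith
  norm_num at hA hB ⊢
  linarith

/-- `√2 · log 2 ≥ 0.980257`. [folklore] -/
lemma sqrt_two_mul_log_two_ge : (0.980257 : ℝ) ≤ Real.sqrt 2 * Real.log 2 := by
  have hs : (1.414213 : ℝ) ≤ Real.sqrt 2 := by
    rw [show (1.414213 : ℝ) = Real.sqrt (1.414213 ^ 2) by rw [Real.sqrt_sq (by norm_num)]]
    exact Real.sqrt_le_sqrt (by norm_num)
  have hl := Real.log_two_gt_d9
  have h := mul_le_mul hs hl.le (by norm_num) (Real.sqrt_nonneg 2)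
  linarith

/-- `ω² b = 4π²/b ≤ (46/5)² · 0.685`. [folklore] -/
lemma ω_sq_mul_b_le : ω ^ 2 * b ≤ (46 / 5 : ℝ) ^ 2 * 0.685 := by
  have hπ := Real.pi_lt_d6
  have hπsq : π ^ 2 < 3.141593 ^ 2 := pow_lt_pow_left₀ hπ Real.pi_pos.le two_ne_zero
  unfold ω b
  rw [show (2 * π / (69 / 100 : ℝ)) ^ 2 * (69 / 100) = π ^ 2 * (400 / 69) by ring]
  norm_num at hπsq ⊢
  linarith

end JensenWindow

/-! ## Part 3. Negativity at `a = log 2` -/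

open JensenWindow WeilContinuous in
/-- **Negativity of the `{∞, 2}` semi-local Weil functional at support radius `log 2`
(explicit-window version of `exists_not_weilSemilocalPositivityOn_two`).** There is a test
function `g` with `supp g ⊆ [−log 2, log 2]` and `E₂(g) < 0`, namely a mollification `g_k` of
`G(x) = sin(2πx/0.69)·1_{[−0.69, 0.69]}`: polar term `≤ 0` (oddness), archimedean term
`≤ (Re ψ(1/4 + 4.6 i) − log π)‖g_k‖² ≤ 0.392·0.695` (Jensen, `‖g_k'‖² ≤ ω² b ≤ 9.2²‖g_k‖²`),
prime-2 term `≤ −(√2 log 2/2)(2·0.343)`; total `< −0.06`. Consequently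
`WeilSemilocalPositivityOn {2} a` fails for every `a ≥ log 2` (monotonicity), while the tree's
certificate gives it for `a ≤ 563/1024` (`weilSemilocalPositivityOn_two_certb`); the threshold
lies in `[563/1024, log 2)`.
[cite: Yoshida1992, §2 eq. (2.1) with the p = 2 term (the form `E₂`); witness and window new] -/
theorem not_weilSemilocalPositivityOn_two_log_two :
    ¬ WeilSemilocalPositivityOn {2} (Real.log 2) := by
  rw [weilSemilocalPositivityOn_two_iff le_rfl]
  push Not
  -- choose the mollification parameter
  have hN := tendsto_weilNorm2Sq_gk
  have hP₁ := (Complex.continuous_re.tendsto _).comp (tendsto_weilConv_weilReflect_gk (Real.log 2))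
  have hP₂ := (Complex.continuous_re.tendsto _).comp (tendsto_weilConv_weilReflect_gk (-Real.log 2))
  rw [weilConv_G_weilReflect_G_log_two, Complex.ofReal_re] at hP₁
  rw [weilConv_G_weilReflect_G_neg, weilConv_G_weilReflect_G_log_two, Complex.ofReal_re] at hP₂
  have hb1 : (0.685 : ℝ) < b := by simp only [b]; norm_num
  have hb2 : b < 0.695 := by simp only [b]; norm_num
  obtain ⟨k, hN1, hN2, hP1, hP2, hk⟩ : ∃ k : ℕ, (0.685 : ℝ) < weilNorm2Sq (gk k) ∧
      weilNorm2Sq (gk k) < 0.695 ∧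
      (0.343 : ℝ) < (weilConv (gk k) (weilReflect (gk k)) (Real.log 2)).re ∧
      (0.343 : ℝ) < (weilConv (gk k) (weilReflect (gk k)) (-Real.log 2)).re ∧ 399 ≤ k := by
    have ev : ∀ᶠ k : ℕ in atTop, (0.685 : ℝ) < weilNorm2Sq (gk k) ∧ weilNorm2Sq (gk k) < 0.695 ∧
        (0.343 : ℝ) < (weilConv (gk k) (weilReflect (gk k)) (Real.log 2)).re ∧
        (0.343 : ℝ) < (weilConv (gk k) (weilReflect (gk k)) (-Real.log 2)).re ∧ 399 ≤ k := by
      filter_upwards [(tendsto_order.1 hN).1 _ hb1, (tendsto_order.1 hN).2 _ hb2,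
        (tendsto_order.1 hP₁).1 _ P_gt, (tendsto_order.1 hP₂).1 _ P_gt,
        eventually_ge_atTop 399] with k h1 h2 h3 h4 h5
      exact ⟨h1, h2, h3, h4, h5⟩
    exact ev.exists
  set g := gk k with hgdef
  have hg : IsWeilTest g := isWeilTest_gk k
  refine ⟨g, hg, tsupport_gk_subset_log_two hk, ?_⟩
  have hN0 : 0 ≤ weilNorm2Sq g := by linarith
  -- polar term `≤ 0`
  have hpolar : 2 * (weilMellin g 0 * conj (weilMellin g 1)).re ≤ 0 := by
    rw [weilMellin_one_eq_neg_of_odd (gk_neg k), map_neg, mul_neg, Complex.neg_re, Complex.mul_conj,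
      Complex.ofReal_re]
    linarith [Complex.normSq_nonneg (weilMellin g 0)]
  -- the weighted integral splits into the archimedean and the prime-2 parts
  have hI1 := integrable_norm_sq_weilMellin_mul_reDigammaQuarter hg
  have hI2 : Integrable fun t : ℝ ↦
      ‖weilMellin g (1 / 2 + t * I)‖ ^ 2 * (2 * Real.cos (t * Real.log 2)) :=
    integrable_norm_sq_weilMellin_mul hg (by fun_prop) (A := 2) (B := 0) (by norm_num) le_rfl
      fun t ↦ by
        rw [zero_mul, add_zero, abs_mul, abs_two]
        exact mul_le_of_le_one_right (by norm_num) (Real.abs_cos_le_one _)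
  have hsplit : ∫ t : ℝ, ‖weilMellin g (1 / 2 + t * I)‖ ^ 2 * weilFirstPrimeWeight t =
      (∫ t : ℝ, ‖weilMellin g (1 / 2 + t * I)‖ ^ 2 * reDigammaQuarter t) -
        Real.sqrt 2 * Real.log 2 / 2 *
          ∫ t : ℝ, ‖weilMellin g (1 / 2 + t * I)‖ ^ 2 * (2 * Real.cos (t * Real.log 2)) := by
    rw [← integral_const_mul, ← integral_sub hI1 (hI2.const_mul _)]
    congr 1 with t
    unfold weilFirstPrimeWeight
    ring
  -- archimedean part: Jensen with `τ = 46/5`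
  have hτ : weilNorm2Sq (deriv g) ≤ (46 / 5 : ℝ) ^ 2 * weilNorm2Sq g := by
    have h1 := weilNorm2Sq_deriv_gk_le k
    have h2 := ω_sq_mul_b_le
    nlinarith
  have harch := weilArch_le_of_jensen hg hτ
  -- prime-2 part: `(1/2π) ∫ |ĝ|² 2cos(t log 2) = Re k_g(log 2) + Re k_g(−log 2)`
  have hrip : 1 / (2 * π) * ∫ t : ℝ, ‖weilMellin g (1 / 2 + t * I)‖ ^ 2 * (2 * Real.cos (t * Real.log 2)) =
      (weilConv g (weilReflect g) (Real.log 2)).re + (weilConv g (weilReflect g) (-Real.log 2)).re := by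
    have h := congrArg Complex.re (weilConv_weilReflect_log_two_add hg)
    rw [Complex.ofReal_re, show (2 * (π : ℂ)) = ((2 * π : ℝ) : ℂ) by push_cast; ring,
      Complex.re_ofReal_mul, Complex.add_re] at h
    have hπ : (2 * π : ℝ) ≠ 0 := by positivity
    rw [← h, ← mul_assoc, one_div_mul_cancel hπ, one_mul]
  -- numerics
  have hρ := reDigammaQuarter_le_d4
  have hlπ := log_pi_ge_d5
  have hs := sqrt_two_mul_log_two_ge
  have e1 : reDigammaQuarter (46 / 5) * weilNorm2Sq g ≤ 1.5358 * weilNorm2Sq g :=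
    mul_le_mul_of_nonneg_right hρ hN0
  have e2 : 1.14472 * weilNorm2Sq g ≤ Real.log π * weilNorm2Sq g :=
    mul_le_mul_of_nonneg_right hlπ hN0
  have e3 : 0.490128 * 0.686 ≤ Real.sqrt 2 * Real.log 2 / 2 *
      ((weilConv g (weilReflect g) (Real.log 2)).re + (weilConv g (weilReflect g) (-Real.log 2)).re) :=
    mul_le_mul (by linarith) (by linarith) (by norm_num) (by linarith)
  unfold weilFirstPrimeQuadratic
  rw [hsplit, mul_sub, ← mul_assoc, mul_comm (1 / (2 * π)) (Real.sqrt 2 * Real.log 2 / 2), mul_assoc,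
    hrip]
  linarith

/-- Packaging: the `{∞, 2}` functional fails to be positive at every radius `a ≥ log 2`
(the family `WeilSemilocalPositivityOn S ·` is antitone in the radius).
[cite: Yoshida1992, §2 eq. (2.1) with the p = 2 term; window new] -/
theorem not_weilSemilocalPositivityOn_two_of_log_two_le {a : ℝ} (ha : Real.log 2 ≤ a) :
    ¬ WeilSemilocalPositivityOn {2} a := fun h ↦
  not_weilSemilocalPositivityOn_two_log_two (h.mono ha)

end Literature.NumberTheory.LFunctions
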